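import Summits.BirchSwinnertonDyer.Rank1Residual.X11b.Three.StepLHalves
import Summits.BirchSwinnertonDyer.Rank1Residual.X11b.EmbeddingDatumPrime
import HarnessLib

/-!
# X11b @ `p = 3`, S10 HALVES@3 — anti-vacuity of the embedding-datum clause of H1 (`BDPExistsAt₃`):
# for an imaginary quadratic `K` and every prime `𝔭 ∋ 3` an embedding datum `ι' : ℚ̄_3 ≃ ℂ` with
# `InducesPrime ι' 𝔭` EXISTS (and `𝔭` is then the prime `𝔭_{ι'}` of `X11b/EmbeddingDatumPrime.lean`)

HONEST FRAMING (cell `b2b-bsdres`, run/shared/lean/b2b/bsd-rank1-residual/, verbatim in every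
file): the goal of the cell is to DELETE the COMBINATION-SHAPED residual classes of the
Birch–Swinnerton-Dyer formula for ALL analytic-rank `≤ 1` elliptic curves over `ℚ` — "full BSD
formula for every rank `≤ 1` curve in class `C`" assembled STRICTLY from published theorems — so
that the rank-`≤ 1` remainder becomes exactly the CONSTRUCTION-SHAPED classes, which are TYPED
(missing-input `Prop`s), NOT attempted. This is not "finishing BSD". Team `x11b3` = N8/O2 (X11b at
`p = 3`: `3 ‖ N`, `r_an = 1`, `E[3]` irreducible): RESEARCH ROUTES; published theorems only; the
construction-shaped remainder is TYPED, not attempted; census output = EVIDENCE, never a Literature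
fact; nothing booked; no label change; O2 stays OPEN; no route opened.

PROVENANCE: team `cells/x11b3/`, sub-target S10 · HALVES@3 (LEAD DEAL #7 R7-13), filed by seat
`b2b-bsdres-x11b3-p7` (gen. 2) as proxy for `b2b-bsdres-x11b3-p9`. The review criteria of record
(`cells/x11b3/LINE-W.md` v1.9h, R-g "anti-vacuity") ask that the existential binders of the HALVES
hypotheses be shown inhabited where that is a theorem. `Three/StepLHalves.lean` (the verbatim port
of route planner 2's sketch) states H1 = `BDPExistsAt₃ W` with the clause
`∃ ι' : PadicAlgCl 3 ≃+* ℂ, InducesPrime ι' 𝔭 ∧ …`; this THEOREMS-ONLY leaf discharges the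
NON-arithmetic part of that existential from sub-cell `b2b-bsdres-multr1-p1`'s
`X11b/EmbeddingDatumPrime.lean` (gen. 20–21: `primeOfEmbeddingDatum`,
`forall_mem_primeOfEmbeddingDatum_iff`, `exists_datum_forall_mem_iff`): for imaginary quadratic `K`
and ANY prime `𝔭` of `𝓞 K` containing `3`, SOME datum `ι' ∈ {ι, ι ∘ conj}` induces `𝔭`, and
conversely a datum inducing `𝔭` pins `𝔭` down as `𝔭_{ι'}`. So the `∃ ι'` of H1 is never the reason
H1 could fail; what H1 asks for beyond it is exactly the BDP/Castella `L` at `3 ‖ N` with its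
periods (W2 of LINE W; in refereed print for the INTEGRALITY half by Hsieh 2014 Thm. 1 per
`cells/x11b3/LIT-TABLE.md` L54 — a reading, not a tree fact). Kept OUT of `StepLHalves.lean` so that
file keeps exactly the imports of the signed sketch and its importers (`Three/CharTorsionOnA1.lean`)
are not rebuilt. Nothing here changes a label or a count; no definition, no fact, no placeholder.
-/

noncomputable section

open NumberField IsDedekindDomain
open Literature.NumberTheory.EllipticCurves

namespace Summit.BirchSwinnertonDyer.Rank1Residual.X11b.Three

variable {K : Type} [Field K] [NumberField K]

/-- **Anti-vacuity of H1's embedding-datum clause, with the datum located**: for an imaginary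
quadratic `K`, a prime `𝔭 ∋ 3` of `𝓞 K` and ANY datum `ι : ℚ̄_3 ≃ ℂ`, one of `ι`, `ι ∘ conj` induces `𝔭`
in the sense of `InducesPrime` (= the compatibility clause of Castella 2018 Thm. 3.1 for every
infinite place). Immediate from `X11b.exists_datum_forall_mem_iff` (multr1-p1, gen. 21).
[cite: Castella2018, Thm. 3.1 (arXiv:1704.06608 p. 9) (compatibility clause only)] -/
theorem exists_inducesPrime_eq_or (hK : IsImaginaryQuadratic K) {𝔭 : HeightOneSpectrum (𝓞 K)}
    (h𝔭 : ((3 : ℕ) : 𝓞 K) ∈ 𝔭.asIdeal) (ι : PadicAlgCl 3 ≃+* ℂ) :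
    ∃ ι' : PadicAlgCl 3 ≃+* ℂ,
      (ι' = ι ∨ ι' = ι.trans (starRingAut : ℂ ≃+* ℂ)) ∧ InducesPrime ι' 𝔭 :=
  X11b.exists_datum_forall_mem_iff 3 ι hK h𝔭

/-- **Anti-vacuity of H1's embedding-datum clause** (R-g of the HALVES@3 review criteria): for an
imaginary quadratic `K` and every prime `𝔭 ∋ 3` of `𝓞 K` there IS a datum `ι' : ℚ̄_3 ≃ ℂ` with
`InducesPrime ι' 𝔭`. (An isomorphism `ℚ̄_3 ≃ ℂ` exists — both are algebraically closed of
characteristic `0` and cardinality `𝔠` — but none is needed as input: consumers of H1 always hold the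
datum `ι` of the BDP interface, so the statement is given relative to a supplied `ι`.)
[cite: Castella2018, Thm. 3.1 (arXiv:1704.06608 p. 9) (compatibility clause only)] -/
theorem exists_inducesPrime (hK : IsImaginaryQuadratic K) {𝔭 : HeightOneSpectrum (𝓞 K)}
    (h𝔭 : ((3 : ℕ) : 𝓞 K) ∈ 𝔭.asIdeal) (ι : PadicAlgCl 3 ≃+* ℂ) :
    ∃ ι' : PadicAlgCl 3 ≃+* ℂ, InducesPrime ι' 𝔭 := by
  obtain ⟨ι', -, h⟩ := exists_inducesPrime_eq_or hK h𝔭 ι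
  exact ⟨ι', h⟩

/-- **The clause pins the prime down**: if `ι'` induces `𝔭` then, for every infinite place `w` of `K`,
`𝔭` IS multr1-p1's `primeOfEmbeddingDatum 3 ι' w.embedding` (`𝔭_{ι'}`, "the prime induced by
`i_3 = ι'⁻¹ ∘ i_∞`"). So H1/H2/H3 of HALVES@3, which quantify over `𝔭` and then ask for `ι'`
inducing it, range over exactly the pairs `(ι', 𝔭_{ι'})` of route R1's currency — the two
bookkeepings (S0's "`𝔭` first" and Castella–Hsieh's "`ι` first") agree. [folklore] -/
theorem eq_primeOfEmbeddingDatum_of_inducesPrime {ι' : PadicAlgCl 3 ≃+* ℂ}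
    {𝔭 : HeightOneSpectrum (𝓞 K)} (h : InducesPrime ι' 𝔭) (w : InfinitePlace K) :
    𝔭 = X11b.primeOfEmbeddingDatum 3 ι' w.embedding :=
  X11b.eq_primeOfEmbeddingDatum_of_forall_mem_iff 3 ι' w.embedding (h w)

/-- Conversely multr1-p1's prime `𝔭_ι := primeOfEmbeddingDatum 3 ι w₀.embedding` of an imaginary
quadratic `K` is induced by `ι` in the sense of `InducesPrime` (the clause for EVERY infinite place,
there being only one). [folklore] -/
theorem inducesPrime_primeOfEmbeddingDatum (hK : IsImaginaryQuadratic K) (ι : PadicAlgCl 3 ≃+* ℂ)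
    (w₀ : InfinitePlace K) : InducesPrime ι (X11b.primeOfEmbeddingDatum 3 ι w₀.embedding) :=
  X11b.forall_mem_primeOfEmbeddingDatum_iff 3 ι hK w₀

/-- `InducesPrime ι' 𝔭` forces `3 ∈ 𝔭` (the prime induced by a `3`-adic datum lies over `3`), so the
hypothesis `((3 : ℕ) : 𝓞 K) ∈ 𝔭.asIdeal` carried next to it in H1/H2/H3 is implied by the clause —
recorded for consumers that want to drop it. [folklore] -/
theorem natCast_mem_of_inducesPrime {ι' : PadicAlgCl 3 ≃+* ℂ} {𝔭 : HeightOneSpectrum (𝓞 K)}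
    (h : InducesPrime ι' 𝔭) : ((3 : ℕ) : 𝓞 K) ∈ 𝔭.asIdeal := by
  obtain ⟨w⟩ := (inferInstance : Nonempty (InfinitePlace K))
  rw [eq_primeOfEmbeddingDatum_of_inducesPrime h w]
  exact X11b.natCast_mem_primeOfEmbeddingDatum 3 ι' w.embedding

end Summit.BirchSwinnertonDyer.Rank1Residual.X11b.Three

end
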